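/-
Copyright: rh-split cell (screw, bridge) gen 19, 2026-08-28.  Splitting search over kernel-typed
RH-equivalences.  A splitting `A ∧ B ⟹ RH` is CONDITIONAL bookkeeping unless `A` and `B` are both
proved; nothing here bears on the truth of RH.
-/
import Mathlib
import HarnessLib
import Literature.Probability.LatticeModels.BesselIDebyeAsymptotics

/-!
# «SLIDING GERM» — the `t → 0` germ of on-line pair traces and off-line atoms (ζ-free kernel algebra)

Object #10 of the (screw, bridge) seat, part A: the TERMWISE layer of the COUNT THEFT LAW of
rh-splitx-theory-1's audit `K7-AUDIT.md` (aa7a24257f2cc0f3) of rh-idea-4's conjecture K7 `SlidingTheft`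
(`PrimeWindowBlindness.lean` v3 §4): replacing a true on-line pair `½ ± iγ` by `½ ± i(γ + η)` changes the
window trace by `g(γ + η, t) - g(γ, t)`, `g(γ, t) = 2(1 - cos γt)/γ²` (`pairTrace`).

* §1 `pairTrace`: the germ sandwich `t² - γ²t⁴/12 ≤ g(γ,t) ≤ t²` (`sq_sub_le_pairTrace`, `pairTrace_le_sq`):
  the `t²`-coefficient of `g(γ,·)` is `1` for EVERY `γ` — a slide is invisible at order `t²`; and the crude
  bounds `0 ≤ g ≤ 4/γ²`.  Tool: `cos x ≤ 1 - x²/2 + x⁴/24` for all real `x` (the landed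
  `Literature.Probability.LatticeModels.cos_le_one_sub_sq_half_add_fourth`, reused — gate `dedup.landed`).
* §2 the `γ`-derivative `∂_γ g = 2t sin(γt)/γ² - 4(1 - cos γt)/γ³` (`hasDerivAt_pairTrace`) with the
  two-regime bounds `|∂_γ g| ≤ (3/5)·γt⁴` for `0 ≤ γt ≤ 1` (`abs_pairTraceDeriv_le_near`; Mathlib's
  `Real.sin_bound` / `Real.cos_bound` remainders, constant `3/5` in place of the memo's `1/5`),
  `|∂_γ g| ≤ 10t/γ²` for `γt ≥ 1` (`abs_pairTraceDeriv_le_far`) and the regime-free `|∂_γ g| ≤ 4t²/γ`.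

Parts B (mean-value slide bounds, the off-line atom germ via `Complex.exp_bound`) and C (finite sums and the
abstract COUNT LAW) import this file.  HONEST LABEL: elementary real analysis about `cos`; an INSTRUMENT for
another seat's conjecture; RH-free; toward RH: 0.  Nothing here bears on the truth of RH.
-/

set_option linter.dupNamespace false

namespace Summit.RiemannHypothesis.RiemannHypothesis.Theorems.Splittings.SlidingGerm

/-! ## 1. The on-line pair trace and its `t → 0` germ -/

/-- The window trace of the on-line conjugate pair `½ ± iγ`: `g(γ, t) = 2(1 - cos γt)/γ²`. -/
noncomputable def pairTrace (γ t : ℝ) : ℝ := 2 * (1 - Real.cos (γ * t)) / γ ^ 2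

/-- `g(γ, t) ≥ 0`. -/
theorem pairTrace_nonneg (γ t : ℝ) : 0 ≤ pairTrace γ t :=
  div_nonneg (mul_nonneg (by norm_num) (sub_nonneg.mpr (Real.cos_le_one _))) (sq_nonneg _)

/-- `g(γ, t) ≤ 4/γ²` (resolved regime bound). -/
theorem pairTrace_le_four_div (γ t : ℝ) : pairTrace γ t ≤ 4 / γ ^ 2 := by
  unfold pairTrace
  refine div_le_div_of_nonneg_right ?_ (sq_nonneg _)
  linarith [Real.neg_one_le_cos (γ * t)]

/-- `g(γ, t) ≤ t²`: the slide-invisible upper germ (`1 - cos x ≤ x²/2`). -/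
theorem pairTrace_le_sq {γ : ℝ} (hγ : γ ≠ 0) (t : ℝ) : pairTrace γ t ≤ t ^ 2 := by
  unfold pairTrace
  rw [div_le_iff₀ (by positivity)]
  have := Real.one_sub_sq_div_two_le_cos (x := γ * t)
  nlinarith [this]

/-- `1 - cos x ≥ x²/2 - x⁴/24`. -/
theorem sq_div_two_sub_le_one_sub_cos (x : ℝ) : x ^ 2 / 2 - x ^ 4 / 24 ≤ 1 - Real.cos x := by
  linarith [Literature.Probability.LatticeModels.cos_le_one_sub_sq_half_add_fourth x]

/-- `g(γ, t) ≥ t² - γ²t⁴/12`: the slide-invisible lower germ. -/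
theorem sq_sub_le_pairTrace {γ : ℝ} (hγ : γ ≠ 0) (t : ℝ) :
    t ^ 2 - γ ^ 2 * t ^ 4 / 12 ≤ pairTrace γ t := by
  unfold pairTrace
  rw [le_div_iff₀ (by positivity)]
  have := sq_div_two_sub_le_one_sub_cos (γ * t)
  nlinarith [this, sq_nonneg γ]

/-- The germ in absolute form: `|g(γ, t) - t²| ≤ γ²t⁴/12`. -/
theorem abs_pairTrace_sub_sq_le {γ : ℝ} (hγ : γ ≠ 0) (t : ℝ) :
    |pairTrace γ t - t ^ 2| ≤ γ ^ 2 * t ^ 4 / 12 := by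
  rw [abs_le]
  constructor
  · linarith [sq_sub_le_pairTrace hγ t]
  · linarith [pairTrace_le_sq hγ t, show 0 ≤ γ ^ 2 * t ^ 4 / 12 by positivity]

/-! ## 2. The `γ`-derivative of the pair trace and its two regimes -/

/-- `∂_γ g(γ, t) = 2t sin(γt)/γ² - 4(1 - cos γt)/γ³`. -/
noncomputable def pairTraceDeriv (γ t : ℝ) : ℝ :=
  2 * t * Real.sin (γ * t) / γ ^ 2 - 4 * (1 - Real.cos (γ * t)) / γ ^ 3

/-- The pair trace is differentiable in the ordinate with derivative `pairTraceDeriv`. -/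
theorem hasDerivAt_pairTrace {γ : ℝ} (hγ : γ ≠ 0) (t : ℝ) :
    HasDerivAt (fun γ' ↦ pairTrace γ' t) (pairTraceDeriv γ t) γ := by
  have h1 : HasDerivAt (fun γ' : ℝ ↦ γ' * t) t γ := by
    simpa using (hasDerivAt_id γ).mul_const t
  have h2 : HasDerivAt (fun γ' : ℝ ↦ Real.cos (γ' * t)) (-Real.sin (γ * t) * t) γ := h1.cos
  have hc : HasDerivAt (fun γ' : ℝ ↦ 2 * (1 - Real.cos (γ' * t))) (2 * (-(-Real.sin (γ * t) * t))) γ :=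
    (h2.const_sub 1).const_mul 2
  have hd : HasDerivAt (fun γ' : ℝ ↦ γ' ^ 2) (2 * γ) γ := by
    simpa using hasDerivAt_pow 2 γ
  have hq := hc.div hd (pow_ne_zero 2 hγ)
  have hq' : HasDerivAt (fun γ' ↦ pairTrace γ' t)
      (((2 * (-(-Real.sin (γ * t) * t))) * γ ^ 2 - 2 * (1 - Real.cos (γ * t)) * (2 * γ)) / (γ ^ 2) ^ 2) γ :=
    hq.congr_of_eventuallyEq (Filter.Eventually.of_forall fun _ ↦ rfl)
  refine hq'.congr_deriv ?_
  unfold pairTraceDeriv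
  field_simp
  ring

/-- Regime-free bound `|∂_γ g| ≤ 4t²/γ` (`|sin x| ≤ |x|`, `1 - cos x ≤ x²/2`). -/
theorem abs_pairTraceDeriv_le_crude {γ t : ℝ} (hγ : 0 < γ) (ht : 0 ≤ t) :
    |pairTraceDeriv γ t| ≤ 4 * t ^ 2 / γ := by
  unfold pairTraceDeriv
  have h1 : |2 * t * Real.sin (γ * t) / γ ^ 2| ≤ 2 * t ^ 2 / γ := by
    rw [abs_div, abs_of_pos (by positivity : (0 : ℝ) < γ ^ 2), abs_mul,
      abs_of_nonneg (by positivity : (0 : ℝ) ≤ 2 * t)]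
    have hs : |Real.sin (γ * t)| ≤ γ * t := by
      simpa [abs_of_nonneg (mul_nonneg hγ.le ht)] using Real.abs_sin_le_abs (x := γ * t)
    rw [div_le_div_iff₀ (by positivity) hγ]
    calc 2 * t * |Real.sin (γ * t)| * γ = (2 * t * γ) * |Real.sin (γ * t)| := by ring
      _ ≤ (2 * t * γ) * (γ * t) := by gcongr
      _ = 2 * t ^ 2 * γ ^ 2 := by ring
  have h2 : |4 * (1 - Real.cos (γ * t)) / γ ^ 3| ≤ 2 * t ^ 2 / γ := by
    rw [abs_div, abs_of_pos (by positivity : (0 : ℝ) < γ ^ 3),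
      abs_of_nonneg (by linarith [Real.cos_le_one (γ * t)] : (0 : ℝ) ≤ 4 * (1 - Real.cos (γ * t)))]
    rw [div_le_div_iff₀ (by positivity) hγ]
    have := Real.one_sub_sq_div_two_le_cos (x := γ * t)
    nlinarith [this, hγ, sq_nonneg t]
  calc |2 * t * Real.sin (γ * t) / γ ^ 2 - 4 * (1 - Real.cos (γ * t)) / γ ^ 3|
      ≤ |2 * t * Real.sin (γ * t) / γ ^ 2| + |4 * (1 - Real.cos (γ * t)) / γ ^ 3| := abs_sub _ _
    _ ≤ 2 * t ^ 2 / γ + 2 * t ^ 2 / γ := add_le_add h1 h2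
    _ = 4 * t ^ 2 / γ := by ring

/-- Far regime `γt ≥ 1`: `|∂_γ g| ≤ 10t/γ²`. -/
theorem abs_pairTraceDeriv_le_far {γ t : ℝ} (hγ : 0 < γ) (ht : 0 ≤ t) (h : 1 ≤ γ * t) :
    |pairTraceDeriv γ t| ≤ 10 * t / γ ^ 2 := by
  unfold pairTraceDeriv
  have h1 : |2 * t * Real.sin (γ * t) / γ ^ 2| ≤ 2 * t / γ ^ 2 := by
    rw [abs_div, abs_of_pos (by positivity : (0 : ℝ) < γ ^ 2), abs_mul,
      abs_of_nonneg (by positivity : (0 : ℝ) ≤ 2 * t)]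
    refine div_le_div_of_nonneg_right ?_ (by positivity)
    have := Real.abs_sin_le_one (γ * t)
    nlinarith [this, ht]
  have h2 : |4 * (1 - Real.cos (γ * t)) / γ ^ 3| ≤ 8 * t / γ ^ 2 := by
    rw [abs_div, abs_of_pos (by positivity : (0 : ℝ) < γ ^ 3),
      abs_of_nonneg (by linarith [Real.cos_le_one (γ * t)] : (0 : ℝ) ≤ 4 * (1 - Real.cos (γ * t)))]
    rw [div_le_div_iff₀ (by positivity) (by positivity)]
    have hc := Real.neg_one_le_cos (γ * t)
    have : 4 * (1 - Real.cos (γ * t)) ≤ 8 := by linarith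
    calc 4 * (1 - Real.cos (γ * t)) * γ ^ 2 ≤ 8 * γ ^ 2 := by nlinarith [sq_nonneg γ]
      _ = 8 * 1 * γ ^ 2 := by ring
      _ ≤ 8 * (γ * t) * γ ^ 2 := by gcongr
      _ = 8 * t * γ ^ 3 := by ring
  calc |2 * t * Real.sin (γ * t) / γ ^ 2 - 4 * (1 - Real.cos (γ * t)) / γ ^ 3|
      ≤ |2 * t * Real.sin (γ * t) / γ ^ 2| + |4 * (1 - Real.cos (γ * t)) / γ ^ 3| := abs_sub _ _
    _ ≤ 2 * t / γ ^ 2 + 8 * t / γ ^ 2 := add_le_add h1 h2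
    _ = 10 * t / γ ^ 2 := by ring

/-- Near regime `0 ≤ γt ≤ 1`: `|∂_γ g| ≤ (3/5)·γ·t⁴` — the `t²/γ`-terms CANCEL (`2t·x/γ² = 2x²/γ³`, `x = γt`),
leaving `-γt⁴/3 + 2t·e₁/γ² + 4e₂/γ³` with Mathlib's remainders `|e₁| ≤ x⁵/100`, `|e₂| ≤ (5/96)x⁴`. -/
theorem abs_pairTraceDeriv_le_near {γ t : ℝ} (hγ : 0 < γ) (ht : 0 ≤ t) (h : γ * t ≤ 1) :
    |pairTraceDeriv γ t| ≤ 3 / 5 * γ * t ^ 4 := by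
  set x := γ * t with hx
  have hx0 : 0 ≤ x := mul_nonneg hγ.le ht
  have hxabs : |x| ≤ 1 := by rw [abs_of_nonneg hx0]; exact h
  set e₁ := Real.sin x - (x - x ^ 3 / 6) with he₁
  set e₂ := Real.cos x - (1 - x ^ 2 / 2) with he₂
  have hb₁ : |e₁| ≤ x ^ 5 / 100 := by
    have := Real.sin_bound hxabs
    rwa [abs_of_nonneg hx0] at this
  have hb₂ : |e₂| ≤ x ^ 4 * (5 / 96) := by
    have := Real.cos_bound hxabs
    rwa [abs_of_nonneg hx0] at this
  have hγ0 : γ ≠ 0 := hγ.ne'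
  have hrew : pairTraceDeriv γ t = -(γ * t ^ 4) / 3 + 2 * t * e₁ / γ ^ 2 + 4 * e₂ / γ ^ 3 := by
    unfold pairTraceDeriv
    have hs : Real.sin (γ * t) = x - x ^ 3 / 6 + e₁ := by rw [he₁, hx]; ring
    have hc : Real.cos (γ * t) = 1 - x ^ 2 / 2 + e₂ := by rw [he₂, hx]; ring
    rw [hs, hc, hx]
    field_simp
    ring
  rw [hrew]
  have hA : |2 * t * e₁ / γ ^ 2| ≤ γ * t ^ 4 / 50 := by
    rw [abs_div, abs_of_pos (by positivity : (0 : ℝ) < γ ^ 2), abs_mul,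
      abs_of_nonneg (by positivity : (0 : ℝ) ≤ 2 * t), div_le_iff₀ (by positivity)]
    have hx5 : x ^ 5 = γ ^ 5 * t ^ 5 := by rw [hx]; ring
    have hxt : x ^ 2 ≤ 1 := by nlinarith
    calc 2 * t * |e₁| ≤ 2 * t * (x ^ 5 / 100) := by gcongr
      _ = γ * t ^ 4 / 50 * γ ^ 2 * x ^ 2 := by rw [hx]; ring
      _ ≤ γ * t ^ 4 / 50 * γ ^ 2 * 1 := by gcongr
      _ = γ * t ^ 4 / 50 * γ ^ 2 := by ring
  have hB : |4 * e₂ / γ ^ 3| ≤ 5 / 24 * γ * t ^ 4 := by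
    rw [abs_div, abs_of_pos (by positivity : (0 : ℝ) < γ ^ 3), abs_mul,
      abs_of_nonneg (by norm_num : (0 : ℝ) ≤ 4), div_le_iff₀ (by positivity)]
    calc 4 * |e₂| ≤ 4 * (x ^ 4 * (5 / 96)) := by gcongr
      _ = 5 / 24 * γ * t ^ 4 * γ ^ 3 := by rw [hx]; ring
  have hC : |-(γ * t ^ 4) / 3| = γ * t ^ 4 / 3 := by
    rw [abs_div, abs_neg, abs_of_nonneg (by positivity : (0 : ℝ) ≤ γ * t ^ 4), abs_of_pos (by norm_num)]
  calc |-(γ * t ^ 4) / 3 + 2 * t * e₁ / γ ^ 2 + 4 * e₂ / γ ^ 3|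
      ≤ |-(γ * t ^ 4) / 3 + 2 * t * e₁ / γ ^ 2| + |4 * e₂ / γ ^ 3| := abs_add_le _ _
    _ ≤ (|-(γ * t ^ 4) / 3| + |2 * t * e₁ / γ ^ 2|) + |4 * e₂ / γ ^ 3| := by
        gcongr; exact abs_add_le _ _
    _ ≤ (γ * t ^ 4 / 3 + γ * t ^ 4 / 50) + 5 / 24 * γ * t ^ 4 := by rw [hC]; gcongr
    _ ≤ 3 / 5 * γ * t ^ 4 := by nlinarith [show 0 ≤ γ * t ^ 4 by positivity]

end Summit.RiemannHypothesis.RiemannHypothesis.Theorems.Splittings.SlidingGerm
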